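import Summits.Ventures.Crystal3D.Theorems.StickyWulffConstantCoaxialWallLawDeficitLedger
import Summits.Ventures.Crystal3D.Theorems.StickyWulffConstantCoaxialWallLawInteriorLedger
import Summits.Ventures.Crystal3D.Theorems.StickyWulffConstantGenericWallFloorSampleDeficitUpper
import Summits.Ventures.Crystal3D.Theorems.StickyWulffConstantGenericWallFloorRigidRung
import Summits.Ventures.Crystal3D.Theorems.StickyWulffConstantNoReconstructionGainLatticeAdhesion
import HarnessLib

/-!
# The payer assembly: an interior payer bound IS the stub-shaped wall inequality (count form and deficit form)

HONEST FRAMING. Part of the venture `Summits/Ventures/Crystal3D` (cell `crystal3d-full`), helper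
`--supports` the crux `CoaxialWallLaw` (stmt-Ventures-19481, `route-Ventures-StickyWulffConstant`),
REGISTERED line `WallLedgerF` (planner cf-p1 gen 16), open stub `stub_coaxialTwoSlabAdhesion`.
RUNG CREDIT ONLY — pure bookkeeping, the LAST step of every residual-free rung of the two-slab cell (written
inline in `…FluxGapTwin`, `…InPlaneTwin`, `…TransGeneric`, `…WordTransPlane`, …), stated once so that the END
ACCOUNTING bricks of any grade (19481-p1 g6 `…ExactInstance`: `22` ends per unsaturated ball; later the sharp
`12 − deg` form) re-assemble into the stub's shape by ONE call:

* `twoSlab_cross_le_of_payers` (COUNT form).  For a pair of grains and `R₀ ≥ 10` there is `C` such that in every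
  clamped cell (`X` `1`-separated, samples `P₁`, `P₂ ⊆ X ∖ P₁` complete) a payer bound
  `c·π·ρ² − C₀·(1+h)·ρ ≤ #{z ∈ X : deg z ≤ 11, −R₀ − 2 ≤ z₂ ≤ h + R₀ + 2}`
  gives `cross(P₁, X∖P₁) + cross(P₂, Y) ≤ D(Y) + (φ₁ + φ₂ − c/2)·π·ρ² + (C + C₀/2)(1 + h)ρ`
  (`affineSampleDeficit_upper` twice, `ledger_ge_faces_add_interior`, the two deficiency splits).
* `twoSlab_cross_le_of_deficit` (DEFICIT form).  The same with the weighted payer bound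
  `c·π·ρ² − C₀·(1+h)·ρ ≤ Σ_{z ∈ X, −R₀−2 ≤ z₂ ≤ h+R₀+2} (12 − deg z)` (`interior_ledger_ge_faces_add_deficit`):
  «each end consumes its own missing contact» — the form the sharp multiplicity (k-fold tops `≤ 12 − deg`) needs
  to reach `c/2 = (√6/4)·sin θ > ½·sin θ` (twins, skew planes) and `½·sin θ` (translations, `…SkewAxis`).

WHAT THIS IS NOT: not the stub; no counting is done here; F-C1 not moved.
-/

noncomputable section

namespace Summit.Ventures.Crystal3D.Theorems

open Summit.Ventures.Crystal3D Finset
open Literature.MathematicalPhysics.StatisticalMechanics (fccStacking barlowStacking contactDeficiency)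
open scoped InnerProductSpace

open scoped Classical in
/-- **The payer assembly, count form.**  See the module docstring. -/
theorem twoSlab_cross_le_of_payers
    (A₁ : EuclideanSpace ℝ (Fin 3) ≃ₗᵢ[ℝ] EuclideanSpace ℝ (Fin 3)) (t₁ : EuclideanSpace ℝ (Fin 3))
    (A₂ : EuclideanSpace ℝ (Fin 3) ≃ₗᵢ[ℝ] EuclideanSpace ℝ (Fin 3)) (t₂ : EuclideanSpace ℝ (Fin 3))
    (R₀ : ℝ) (hR₀ : 10 ≤ R₀) :
    ∃ C : ℝ, ∀ h : ℝ, 0 ≤ h → ∀ ρ : ℝ, R₀ ≤ ρ →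
      ∀ X P₁ P₂ : Finset (EuclideanSpace ℝ (Fin 3)),
      (∀ p ∈ X, ∀ q ∈ X, p ≠ q → 1 ≤ dist p q) → P₁ ⊆ X → P₂ ⊆ X \ P₁ →
      (∀ p ∈ X, -(2 * R₀) ≤ p 2 ∧ p 2 ≤ h + 2 * R₀ ∧ p 0 ^ 2 + p 1 ^ 2 ≤ ρ ^ 2) →
      (∀ p, p ∈ P₁ ↔ (p ∈ (fun q => A₁ q + t₁) '' fccStacking 1 (Real.sqrt (2 / 3)) ∧
        -(2 * R₀) ≤ p 2 ∧ p 2 ≤ -R₀ ∧ p 0 ^ 2 + p 1 ^ 2 ≤ ρ ^ 2)) →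
      (∀ p, p ∈ P₂ ↔ (p ∈ (fun q => A₂ q + t₂) '' fccStacking 1 (Real.sqrt (2 / 3)) ∧
        h + R₀ ≤ p 2 ∧ p 2 ≤ h + 2 * R₀ ∧ p 0 ^ 2 + p 1 ^ 2 ≤ ρ ^ 2)) →
      ∀ c C₀ : ℝ, 0 ≤ C₀ →
      c * Real.pi * ρ ^ 2 - C₀ * (1 + h) * ρ ≤
        ((X.filter fun z => (X.filter fun q => dist z q = 1).card ≤ 11 ∧
          -R₀ - 2 ≤ z 2 ∧ z 2 ≤ h + R₀ + 2).card : ℝ) →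
      ((((P₁ ×ˢ (X \ P₁)).filter fun pq => dist pq.1 pq.2 = 1).card : ℕ) : ℝ) +
        ((((P₂ ×ˢ ((X \ P₁) \ P₂)).filter fun pq => dist pq.1 pq.2 = 1).card : ℕ) : ℝ) ≤
        contactDeficiency ((X \ P₁) \ P₂) +
          (Real.sqrt 2 / 4 * ∑ᶠ w ∈ {w ∈ fccStacking 1 (Real.sqrt (2 / 3)) | ‖w‖ = 1},
              |⟪w, A₁.symm (EuclideanSpace.single (2 : Fin 3) (1 : ℝ))⟫_ℝ| +
            Real.sqrt 2 / 4 * ∑ᶠ w ∈ {w ∈ fccStacking 1 (Real.sqrt (2 / 3)) | ‖w‖ = 1},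
              |⟪w, A₂.symm (EuclideanSpace.single (2 : Fin 3) (1 : ℝ))⟫_ℝ| - c / 2) * Real.pi * ρ ^ 2 +
          (C + C₀ / 2) * (1 + h) * ρ := by
  set e₃ : EuclideanSpace ℝ (Fin 3) := EuclideanSpace.single (2 : Fin 3) (1 : ℝ) with he₃
  obtain ⟨C₁, hC₁⟩ := affineSampleDeficit_upper A₁ t₁ R₀ (by linarith)
  obtain ⟨C₂, hC₂⟩ := affineSampleDeficit_upper A₂ t₂ R₀ (by linarith)
  refine ⟨|C₁| + |C₂| + (240 * Real.sqrt 2 * Real.pi + 3120 * (4 * R₀ + 2)) / 2, ?_⟩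
  intro h hh ρ hρ X P₁ P₂ hX hP₁X hP₂X₁ hcyl hP₁ hP₂ c C₀ hC₀ hpay
  set φ₁ : ℝ := Real.sqrt 2 / 4 * ∑ᶠ w ∈ {w ∈ fccStacking 1 (Real.sqrt (2 / 3)) | ‖w‖ = 1},
      |⟪w, A₁.symm e₃⟫_ℝ| with hφ₁
  set φ₂ : ℝ := Real.sqrt 2 / 4 * ∑ᶠ w ∈ {w ∈ fccStacking 1 (Real.sqrt (2 / 3)) | ‖w‖ = 1},
      |⟪w, A₂.symm e₃⟫_ℝ| with hφ₂
  have hP₂X : P₂ ⊆ X := hP₂X₁.trans sdiff_subset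
  have hρ0 : (0 : ℝ) ≤ ρ := by linarith
  -- (1) the two slab samples from above
  have hD₁ := hC₁ (-(2 * R₀)) (-R₀) (by ring) ρ hρ P₁ hP₁
  have hD₂ := hC₂ (h + R₀) (h + 2 * R₀) (by ring) ρ hρ P₂ hP₂
  -- (2) the interior ledger
  have hled := ledger_ge_faces_add_interior A₁ t₁ A₂ t₂ X P₁ P₂ R₀ h ρ hR₀ hh hρ hX hcyl hP₁X hP₂X hP₁ hP₂
  have hf₁ : Real.sqrt 2 / 4 * ∑ w ∈ fccSlots, |⟪A₁ w, e₃⟫_ℝ| = φ₁ := by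
    rw [hφ₁, finsum_unit_fcc_symm_eq_sum_slots]
  have hf₂ : Real.sqrt 2 / 4 * ∑ w ∈ fccSlots, |⟪A₂ w, e₃⟫_ℝ| = φ₂ := by
    rw [hφ₂, finsum_unit_fcc_symm_eq_sum_slots]
  rw [hf₁, hf₂, ← two_mul_contactDeficiency_eq_sum X] at hled
  have hPAY : ((X.filter fun z => (X.filter fun q => dist z q = 1).card ≤ 11 ∧
        -R₀ - 2 ≤ z 2 ∧ z 2 ≤ h + R₀ + 2).card : ℝ) ≤
      ((X.filter fun y => (X.filter fun q => dist y q = 1).card ≠ 12 ∧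
        -R₀ - 2 ≤ y 2 ∧ y 2 ≤ h + R₀ + 2).card : ℝ) := by
    exact_mod_cast card_le_card fun z hz => by
      rw [mem_filter] at hz ⊢
      exact ⟨hz.1, by have := hz.2.1; omega, hz.2.2⟩
  -- (3) the two splits of the skeleton
  have hs₁ := contactDeficiency_sdiff_split hP₁X
  have hs₂ := contactDeficiency_sdiff_split hP₂X₁
  -- (4) assemble
  have ha : C₁ * ρ ≤ |C₁| * (1 + h) * ρ := by
    have h1 : C₁ * ρ ≤ |C₁| * ρ := mul_le_mul_of_nonneg_right (le_abs_self _) hρ0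
    have h2 : 0 ≤ |C₁| * h * ρ := by positivity
    linarith only [h1, h2]
  have hb : C₂ * ρ ≤ |C₂| * (1 + h) * ρ := by
    have h1 : C₂ * ρ ≤ |C₂| * ρ := mul_le_mul_of_nonneg_right (le_abs_self _) hρ0
    have h2 : 0 ≤ |C₂| * h * ρ := by positivity
    linarith only [h1, h2]
  set PAY' : Finset (EuclideanSpace ℝ (Fin 3)) := X.filter fun y => (X.filter fun q => dist y q = 1).card ≠ 12 ∧
    -R₀ - 2 ≤ y 2 ∧ y 2 ≤ h + R₀ + 2
  have t1 : ((((P₁ ×ˢ (X \ P₁)).filter fun pq => dist pq.1 pq.2 = 1).card : ℕ) : ℝ) +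
      ((((P₂ ×ˢ ((X \ P₁) \ P₂)).filter fun pq => dist pq.1 pq.2 = 1).card : ℕ) : ℝ) =
      contactDeficiency P₁ + contactDeficiency P₂ + contactDeficiency ((X \ P₁) \ P₂) -
        contactDeficiency X := by linarith only [hs₁, hs₂]
  have t2 : c * Real.pi * ρ ^ 2 - C₀ * (1 + h) * ρ ≤ (PAY'.card : ℝ) := by linarith only [hpay, hPAY]
  have t3 : 2 * φ₁ * Real.pi * ρ ^ 2 + 2 * φ₂ * Real.pi * ρ ^ 2 + (PAY'.card : ℝ) -
      (240 * Real.sqrt 2 * Real.pi + 3120 * (4 * R₀ + 2)) * (1 + h) * ρ ≤ 2 * contactDeficiency X := by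
    linarith only [hled]
  have t4 : contactDeficiency P₁ ≤ 2 * φ₁ * Real.pi * ρ ^ 2 + C₁ * ρ := hD₁
  have t5 : contactDeficiency P₂ ≤ 2 * φ₂ * Real.pi * ρ ^ 2 + C₂ * ρ := hD₂
  linarith only [t1, t2, t3, t4, t5, ha, hb]

open scoped Classical in
/-- **The payer assembly, deficit form** («each end consumes its own missing contact»).  See the module
docstring. -/
theorem twoSlab_cross_le_of_deficit
    (A₁ : EuclideanSpace ℝ (Fin 3) ≃ₗᵢ[ℝ] EuclideanSpace ℝ (Fin 3)) (t₁ : EuclideanSpace ℝ (Fin 3))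
    (A₂ : EuclideanSpace ℝ (Fin 3) ≃ₗᵢ[ℝ] EuclideanSpace ℝ (Fin 3)) (t₂ : EuclideanSpace ℝ (Fin 3))
    (R₀ : ℝ) (hR₀ : 10 ≤ R₀) :
    ∃ C : ℝ, ∀ h : ℝ, 0 ≤ h → ∀ ρ : ℝ, R₀ ≤ ρ →
      ∀ X P₁ P₂ : Finset (EuclideanSpace ℝ (Fin 3)),
      (∀ p ∈ X, ∀ q ∈ X, p ≠ q → 1 ≤ dist p q) → P₁ ⊆ X → P₂ ⊆ X \ P₁ →
      (∀ p ∈ X, -(2 * R₀) ≤ p 2 ∧ p 2 ≤ h + 2 * R₀ ∧ p 0 ^ 2 + p 1 ^ 2 ≤ ρ ^ 2) →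
      (∀ p, p ∈ P₁ ↔ (p ∈ (fun q => A₁ q + t₁) '' fccStacking 1 (Real.sqrt (2 / 3)) ∧
        -(2 * R₀) ≤ p 2 ∧ p 2 ≤ -R₀ ∧ p 0 ^ 2 + p 1 ^ 2 ≤ ρ ^ 2)) →
      (∀ p, p ∈ P₂ ↔ (p ∈ (fun q => A₂ q + t₂) '' fccStacking 1 (Real.sqrt (2 / 3)) ∧
        h + R₀ ≤ p 2 ∧ p 2 ≤ h + 2 * R₀ ∧ p 0 ^ 2 + p 1 ^ 2 ≤ ρ ^ 2)) →
      ∀ c C₀ : ℝ, 0 ≤ C₀ →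
      c * Real.pi * ρ ^ 2 - C₀ * (1 + h) * ρ ≤
        ∑ z ∈ X.filter (fun z => -R₀ - 2 ≤ z 2 ∧ z 2 ≤ h + R₀ + 2),
          ((12 : ℝ) - ((X.filter fun q => dist z q = 1).card : ℝ)) →
      ((((P₁ ×ˢ (X \ P₁)).filter fun pq => dist pq.1 pq.2 = 1).card : ℕ) : ℝ) +
        ((((P₂ ×ˢ ((X \ P₁) \ P₂)).filter fun pq => dist pq.1 pq.2 = 1).card : ℕ) : ℝ) ≤
        contactDeficiency ((X \ P₁) \ P₂) +
          (Real.sqrt 2 / 4 * ∑ᶠ w ∈ {w ∈ fccStacking 1 (Real.sqrt (2 / 3)) | ‖w‖ = 1},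
              |⟪w, A₁.symm (EuclideanSpace.single (2 : Fin 3) (1 : ℝ))⟫_ℝ| +
            Real.sqrt 2 / 4 * ∑ᶠ w ∈ {w ∈ fccStacking 1 (Real.sqrt (2 / 3)) | ‖w‖ = 1},
              |⟪w, A₂.symm (EuclideanSpace.single (2 : Fin 3) (1 : ℝ))⟫_ℝ| - c / 2) * Real.pi * ρ ^ 2 +
          (C + C₀ / 2) * (1 + h) * ρ := by
  set e₃ : EuclideanSpace ℝ (Fin 3) := EuclideanSpace.single (2 : Fin 3) (1 : ℝ) with he₃
  obtain ⟨C₁, hC₁⟩ := affineSampleDeficit_upper A₁ t₁ R₀ (by linarith)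
  obtain ⟨C₂, hC₂⟩ := affineSampleDeficit_upper A₂ t₂ R₀ (by linarith)
  refine ⟨|C₁| + |C₂| + (240 * Real.sqrt 2 * Real.pi + 5760 * (4 * R₀ + 2)) / 2, ?_⟩
  intro h hh ρ hρ X P₁ P₂ hX hP₁X hP₂X₁ hcyl hP₁ hP₂ c C₀ hC₀ hpay
  set φ₁ : ℝ := Real.sqrt 2 / 4 * ∑ᶠ w ∈ {w ∈ fccStacking 1 (Real.sqrt (2 / 3)) | ‖w‖ = 1},
      |⟪w, A₁.symm e₃⟫_ℝ| with hφ₁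
  set φ₂ : ℝ := Real.sqrt 2 / 4 * ∑ᶠ w ∈ {w ∈ fccStacking 1 (Real.sqrt (2 / 3)) | ‖w‖ = 1},
      |⟪w, A₂.symm e₃⟫_ℝ| with hφ₂
  have hP₂X : P₂ ⊆ X := hP₂X₁.trans sdiff_subset
  have hρ0 : (0 : ℝ) ≤ ρ := by linarith
  -- (1) the two slab samples from above
  have hD₁ := hC₁ (-(2 * R₀)) (-R₀) (by ring) ρ hρ P₁ hP₁
  have hD₂ := hC₂ (h + R₀) (h + 2 * R₀) (by ring) ρ hρ P₂ hP₂
  -- (2) the deficit ledger, credited set = the interior window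
  have hled := interior_ledger_ge_faces_add_deficit A₁ t₁ A₂ t₂ X P₁ P₂ R₀ h ρ hR₀ hh hρ hX hcyl hP₁X hP₂X hP₁ hP₂
    (fun y => -R₀ - 2 ≤ y 2 ∧ y 2 ≤ h + R₀ + 2)
    (fun y _ hy _ => ⟨by linarith [hy.1], by linarith [hy.2]⟩)
  beta_reduce at hled
  have hf₁ : Real.sqrt 2 / 4 * ∑ w ∈ fccSlots, |⟪A₁ w, e₃⟫_ℝ| = φ₁ := by
    rw [hφ₁, finsum_unit_fcc_symm_eq_sum_slots]
  have hf₂ : Real.sqrt 2 / 4 * ∑ w ∈ fccSlots, |⟪A₂ w, e₃⟫_ℝ| = φ₂ := by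
    rw [hφ₂, finsum_unit_fcc_symm_eq_sum_slots]
  rw [hf₁, hf₂, ← two_mul_contactDeficiency_eq_sum X] at hled
  -- (3) the two splits of the skeleton
  have hs₁ := contactDeficiency_sdiff_split hP₁X
  have hs₂ := contactDeficiency_sdiff_split hP₂X₁
  -- (4) assemble
  have ha : C₁ * ρ ≤ |C₁| * (1 + h) * ρ := by
    have h1 : C₁ * ρ ≤ |C₁| * ρ := mul_le_mul_of_nonneg_right (le_abs_self _) hρ0
    have h2 : 0 ≤ |C₁| * h * ρ := by positivity
    linarith only [h1, h2]
  have hb : C₂ * ρ ≤ |C₂| * (1 + h) * ρ := by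
    have h1 : C₂ * ρ ≤ |C₂| * ρ := mul_le_mul_of_nonneg_right (le_abs_self _) hρ0
    have h2 : 0 ≤ |C₂| * h * ρ := by positivity
    linarith only [h1, h2]
  set S : ℝ := ∑ z ∈ X.filter (fun z => -R₀ - 2 ≤ z 2 ∧ z 2 ≤ h + R₀ + 2),
    ((12 : ℝ) - ((X.filter fun q => dist z q = 1).card : ℝ)) with hS
  have t1 : ((((P₁ ×ˢ (X \ P₁)).filter fun pq => dist pq.1 pq.2 = 1).card : ℕ) : ℝ) +
      ((((P₂ ×ˢ ((X \ P₁) \ P₂)).filter fun pq => dist pq.1 pq.2 = 1).card : ℕ) : ℝ) =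
      contactDeficiency P₁ + contactDeficiency P₂ + contactDeficiency ((X \ P₁) \ P₂) -
        contactDeficiency X := by linarith only [hs₁, hs₂]
  have t3 : 2 * φ₁ * Real.pi * ρ ^ 2 + 2 * φ₂ * Real.pi * ρ ^ 2 + S -
      (240 * Real.sqrt 2 * Real.pi + 5760 * (4 * R₀ + 2)) * (1 + h) * ρ ≤ 2 * contactDeficiency X := by
    convert hled using 7
  have t2 : c * Real.pi * ρ ^ 2 - C₀ * (1 + h) * ρ ≤ S := hpay
  have t4 : contactDeficiency P₁ ≤ 2 * φ₁ * Real.pi * ρ ^ 2 + C₁ * ρ := hD₁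
  have t5 : contactDeficiency P₂ ≤ 2 * φ₂ * Real.pi * ρ ^ 2 + C₂ * ρ := hD₂
  linarith only [t1, t2, t3, t4, t5, ha, hb]

end Summit.Ventures.Crystal3D.Theorems

end
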